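import Literature.AnabelianGeometry.EtaleTheta.Discharge.Sec4Prop42LawsBaseFieldHull
import Literature.AnabelianGeometry.EtaleTheta.TemperedFrobenioidOfRankOneBaseRatFn
import Literature.AnabelianGeometry.EtaleTheta.Discharge.Sec4MuSaturatedOfRatFnTorsion
import Literature.AnabelianGeometry.EtaleTheta.Discharge.Sec4Prop42SubRootLawTreeVocabWeak
import Literature.AnabelianGeometry.EtaleTheta.Discharge.Sec5OfConnectedTemperoid
import HarnessLib

/-!
# [EtTh] Prop. 4.2 (iii) AT THE BASE-FIELD-THEORETIC HULL: the cyclotomic covering law `hμ₀` (genuine cyclotomic theory) and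
# «N-th-root objects exist» — Prop. 4.2 (iii) AS TYPED over `B^temp(Π^tp_X)⁰` with the trivial `(N,H)`-slot — PROOF-ONLY

S. Mochizuki, *The étale theta function and its Frobenioid-theoretic manifestations*, Publ. RIMS **45** (2009) [MochizukiEtTh2009],
Prop. 4.2 (iii) pp.314–315 (PDF pp.88–89), proof p.315 (PDF p.89): «it follows from the fact that `K_N ∋ ζ_N` [§1, p.13: `K_N := K(μ_N, …)`]
that after passing to an appropriate tempered covering … the object becomes `μ_N`-saturated [[FrdII] Def. 2.1 (i), Rmk. 2.2.1]»;
Def. 3.3 (iii) p.299 (PDF p.73) (the constants `K_U^×` among the functions); Def. 3.6 (iv) p.304 (PDF p.78) (`C^{bs-fld}`).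
[cite: MochizukiEtTh2009, Prop 4.2 (iii) p.315 (PDF p.89); Def 3.6 (iv) p.304 (PDF p.78)]

abc-iut cell, layer L2, seat abc-iut-L2-d3 (gen 10), row R1112 «CONST-DICT CARRIER = C^{bs-fld} HULL OVER THE GENUINE BASE»,
junction step (c) (abc-iut-L2-lead R1302 GO).  PROOF-ONLY (0 definitions, no `Prop`-valued definition, no instance, no notation, no sorry)
over this lineage's hull `BsFldHull.temperedFrobenioid p a ha hΓ R S` (`TemperedFrobenioidOfBaseFieldHull.lean`, p500929) — the tempered
Frobenioid over the GENUINE base `B^temp(Γ)⁰` whose Def. 3.3 (iii) functions `B₀(Γ/U) = Hom_Γ(Γ/U, ℚ̄_p^×) ≅ K_U^×` are genuine `ℚ̄_p`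
constants (`K_U := ℚ̄_p^{a(U)}`, `a : Γ → G_{ℚ_p}` continuous with open images):
* §1 torsion functions: a function `b ∈ B₀(Γ/U)` with `b^N = 1` has trivial log-divisor (`divZero_eq_one_of_pow_eq_one`) and, as soon as
  `K_U ∋ ζ` a primitive `N`-th root of unity, is a power of the constant `ζ` (`exists_ofFixed_pow_eq_of_pow_eq_one`: the `N`-th roots of
  unity of the field `ℚ̄_p` are cyclic, Mathlib `IsPrimitiveRoot.eq_pow_of_mem_rootsOfUnity`);
* §2 the CYCLOTOMIC COVERING: every Galois `Y ∈ B^temp(Γ)⁰` is dominated by a Galois `Y′ → Y` whose field of constants contains a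
  `G_{ℚ_p}`-translate of any given finite `E/ℚ_p` (`exists_galoisCover_apply_mem_fixFld`: the open subgroup `U ∩ a⁻¹(G_E)` dominated by
  a Galois object, abc-iut-L2-t3's `CosetCat.hLift_galois_of_full_essSurj`), whence contains a primitive `N`-th root of unity
  (`exists_galoisCover_isPrimitiveRoot`, print's «`K_N ∋ ζ_N`»);
* §3 **`BsFldHull.cyclotomicLaw`** — abc-iut-w6-d037's base-level cyclotomic covering law `hμ₀` of
  `Prop42Sub.prop42_iii_mkOfModelCanonical_trivNH_of_cyclotomicLaw` (`Sec4MuSaturatedOfRatFnTorsion.lean`) HOLDS at the hull: over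
  `Y′` the `N`-torsion of `Ker Div_B(Y′)` is cyclic of order `N`, generated by the constant function `ζ_N` (transported through this
  lineage's dictionary `B₀(Γ/U′) ≅ B(Y′)`, `RankOneBase.ratFnEquiv`, p505310);
* §4 **`BsFldHull.rootLaw`** (the E2 root law `hR` for `B`, from A10 `baseRootLaw` p508246 + abc-iut-w6-d037's `hTF`
  `pow_injective_ΦR_gp_treeVocabWeak` through abc-iut-L2-t3's `rootLaw_of_baseRootLaw'`) and **`BsFldHull.prop42_iii_mkOfConnectedTemperoid_trivNH`**
  — [EtTh] Prop. 4.2 (iii) AS TYPED (`BiKummerSetting.Prop42_iii`: every pre-root-Frobenius-trivial Galois-based `A′` is dominated by a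
  pull-back morphism from a `μ_N`-saturated Galois-based `A″`, i.e. N-TH-ROOT OBJECTS EXIST) for abc-iut-L2-t4's §4 setting
  `mkOfConnectedTemperoid X (BsFldHull.temperedFrobenioid …) …` over `B^temp(Π^tp_X)⁰` with the trivial `(N,H)`-slot, EVERY binder a
  theorem: `Φ` divisorial (Def. 3.6 (ii) field), `hDSpull` (p508246), `hR` (§4), `hμ₀` (§3), `hS` (abc-iut-L2-t4's
  `mkOfConnectedTemperoid_galoisSurj_natural`).
HONEST FRAMING: classical cyclotomic/Kummer theory at a carrier with degenerate divisor geometry (one prime per object); nothing of [EtTh]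
beyond the typed statements is asserted; nothing here bears on [IUTchIII] Cor. 3.12; no side taken; typed ≠ proved elsewhere.
-/

noncomputable section

namespace Literature.AnabelianGeometry.EtaleTheta

open CategoryTheory Opposite Function Literature.AlgebraicGeometry.Frobenioids Literature.AnabelianGeometry.SemiGraphs
  Literature.AlgebraicGeometry.Frobenioids.RationalOrd

namespace BsFldHull

section Hull

variable (p : ℕ) [Fact p.Prime] {Γ : Type} [Group Γ] [TopologicalSpace Γ] (a : Γ →* GQp p)
  (ha : ∀ U : OpenSubgroup Γ, IsOpen ((U.toSubgroup.map a : Subgroup (GQp p)) : Set (GQp p)))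

/-! ## §1 Torsion functions of `B₀(Γ/U)`: trivial divisor, powers of `ζ_N` -/

/-- The order of a torsion element of `ℚ̄_p^×` is `0` (`N · ord(x) = ord(x^N) = ord(1) = 0`) — private helper. [folklore] -/
private theorem ordFun_eq_zero_of_pow_eq_one {x : PadicAlgCl p} {N : ℕ} (hN : 0 < N) (hx : x ^ N = 1) : ordFun p x = 0 := by
  have hx0 : x ≠ 0 := by
    rintro rfl
    rw [zero_pow hN.ne'] at hx
    exact zero_ne_one hx
  have h := ordFun_pow p hx0 N
  rw [hx, ordFun_one] at h
  have hN' : (N : ℚ) ≠ 0 := by exact_mod_cast hN.ne'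
  exact (mul_eq_zero.mp h.symm).resolve_left hN'

/-- **A torsion function has trivial log-divisor**: `b^N = 1` in `B₀(Γ/U)` forces `div₀ b = 1` (its value at the base point is a root of
unity, of order `0`).  [cite: MochizukiEtTh2009, Def 3.3 (iii) p.299 (PDF p.73)] -/
theorem divZero_eq_one_of_pow_eq_one (U : CosetCat Γ) (b : eqvFun p a U) {N : ℕ} (hN : 0 < N) (hb : b ^ N = 1) :
    divZero p a ha U b = 1 := by
  have hev : ((ev p a U b : (PadicAlgCl p)ˣ) : PadicAlgCl p) ^ N = 1 := by
    rw [← Units.val_pow_eq_pow_val, ← map_pow, hb, map_one, Units.val_one]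
  have hord : ordIdx p a ha U b = 0 := by
    have h := ordIdx_cast p a ha U b
    rw [ordFun_eq_zero_of_pow_eq_one p hN hev, mul_zero] at h
    exact_mod_cast h
  rw [divZero_apply, hord, zpow_zero]

/-- The order of the constant function with value `x ∈ K_U^×` is the order of `x` (`ev` is injective). [cite: MochizukiEtTh2009, Prop 3.4 (ii) p.300 (PDF p.74)] -/
theorem orderOf_ofFixed (U : CosetCat Γ) (x : (PadicAlgCl p)ˣ) (hx : (x : PadicAlgCl p) ∈ fixFld p a U.sg) :
    orderOf (ofFixed p a U x hx) = orderOf x := by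
  rw [← orderOf_injective (ev p a U) (ev_injective p a U) (ofFixed p a U x hx), ev_ofFixed]

/-- **Roots of unity among the functions are powers of `ζ_N`**: if `K_U` contains a primitive `N`-th root of unity `ζ`, every `b ∈ B₀(Γ/U)`
with `b^N = 1` is a power of the constant function `ζ` (the `N`-th roots of unity of the field `ℚ̄_p` form the cyclic group `⟨ζ⟩`).
[cite: MochizukiEtTh2009, Prop 4.2 (iii) p.315 (PDF p.89)] -/
theorem exists_ofFixed_pow_eq_of_pow_eq_one (U : CosetCat Γ) {N : ℕ+} {ζ : (PadicAlgCl p)ˣ} (hζ : IsPrimitiveRoot ζ (N : ℕ))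
    (hζU : (ζ : PadicAlgCl p) ∈ fixFld p a U.sg) (b : eqvFun p a U) (hb : b ^ (N : ℕ) = 1) :
    ∃ i : ℕ, ofFixed p a U ζ hζU ^ i = b := by
  have hbN : ev p a U b ∈ rootsOfUnity (N : ℕ) (PadicAlgCl p) := by
    rw [mem_rootsOfUnity, ← map_pow, hb, map_one]
  obtain ⟨i, -, hi⟩ := hζ.eq_pow_of_mem_rootsOfUnity hbN
  exact ⟨i, ev_injective p a U (by rw [map_pow, ev_ofFixed, hi])⟩

/-! ## §2 The cyclotomic covering of a Galois object -/

variable [IsTopologicalGroup Γ] (hΓ : IsTempered Γ)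

/-- **The Kummer/cyclotomic covering of a Galois object**: for `E/ℚ_p` finite and `Y ∈ B^temp(Γ)⁰` Galois there are a Galois `Y′ → Y` and
`γ ∈ Γ` with `a(γ)·E ⊆ K_{U′}`, `Γ/U′` the coset space re-presenting `Y′` — dominate the open subgroup `U ∩ a⁻¹(G_E)` (open: `a` continuous,
`G_E` open) by a Galois object ([SemiAnbd] Rmk. 3.1.3, abc-iut-L2-t3's `CosetCat.hLift_galois_of_full_essSurj`); the comparison map
`Γ/U′ → Γ/(U ∩ a⁻¹(G_E))` sends `1 ↦ γ`, so `U′ ⊆ γ (U ∩ a⁻¹(G_E)) γ⁻¹` fixes `a(γ)·E`.  [cite: MochizukiEtTh2009, Prop 4.2 (iii) p.315 (PDF p.89)] -/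
theorem exists_galoisCover_apply_mem_fixFld (hcont : Continuous a) (E : IntermediateField ℚ_[p] (PadicAlgCl p)) [FiniteDimensional ℚ_[p] E]
    (Y : ConnectedPart (BTemp Γ)) (hY : IsGaloisObj Y.obj) :
    ∃ (Y' : ConnectedPart (BTemp Γ)) (_ : IsGaloisObj Y'.obj) (_ : Y' ⟶ Y) (γ : Γ),
      ∀ x : PadicAlgCl p, x ∈ E → a γ x ∈ fixFld p a ((CosetCat.equivConnectedPart hΓ).inverse.obj Y').sg := by
  have hYF : IsGaloisObj ((CosetCat.toConnected hΓ).obj ((CosetCat.equivConnectedPart hΓ).inverse.obj Y)).obj :=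
    (CosetCat.isGaloisObj_toConnected_inverse_iff hΓ Y).2 hY
  have hopenE : IsOpen ((E.fixingSubgroup : Subgroup (GQp p)) : Set (GQp p)) := IntermediateField.fixingSubgroup_isOpen E
  let W : OpenSubgroup Γ := ⟨(((CosetCat.equivConnectedPart hΓ).inverse.obj Y).sg : Subgroup Γ) ⊓ E.fixingSubgroup.comap a,
    ((CosetCat.equivConnectedPart hΓ).inverse.obj Y).sg.isOpen.inter (hopenE.preimage hcont)⟩
  let f : (⟨W⟩ : CosetCat Γ) ⟶ (CosetCat.equivConnectedPart hΓ).inverse.obj Y :=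
    CosetCat.homMk ((1 : Γ) : ((CosetCat.equivConnectedPart hΓ).inverse.obj Y).carrier) fun v hv => by
      rw [MulAction.Quotient.smul_coe, smul_eq_mul, mul_one, QuotientGroup.eq, mul_one, inv_mem_iff]
      exact hv.1
  obtain ⟨Y', hY', c, g, -⟩ := CosetCat.hLift_galois_of_full_essSurj (CosetCat.equivConnectedPart hΓ).inverse hΓ Y hYF ⟨W⟩ f
  obtain ⟨γ, hγ⟩ := CosetCat.exists_smul_one_eq (⟨W⟩ : CosetCat Γ) (CosetCat.pt g)
  refine ⟨Y', (CosetCat.isGaloisObj_toConnected_inverse_iff hΓ Y').1 hY', c, γ, fun x hx => ?_⟩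
  rw [mem_fixFld_iff]
  intro w hw
  -- `γ⁻¹ w γ` lies in `W = U ∩ a⁻¹(G_E)`
  have hmem : γ⁻¹ * w * γ ∈ W := by
    apply (CosetCat.smul_one_eq_one_iff (⟨W⟩ : CosetCat Γ) _).1
    have h1 : w • CosetCat.pt g = CosetCat.pt g := CosetCat.smul_pt g hw
    rw [← hγ] at h1
    rw [mul_smul, mul_smul, h1, ← mul_smul, inv_mul_cancel, one_smul]
  have hfix : a (γ⁻¹ * w * γ) x = x := (IntermediateField.mem_fixingSubgroup_iff _ _).mp hmem.2 x hx
  have hwγ : γ * (γ⁻¹ * w * γ) = w * γ := by rw [mul_assoc γ⁻¹, mul_inv_cancel_left]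
  calc a w (a γ x) = a (w * γ) x := by rw [map_mul, AlgEquiv.mul_apply]
    _ = a (γ * (γ⁻¹ * w * γ)) x := by rw [hwγ]
    _ = a γ (a (γ⁻¹ * w * γ) x) := by rw [map_mul, AlgEquiv.mul_apply]
    _ = a γ x := by rw [hfix]

/-- **«`K_N ∋ ζ_N`» over a Galois cover**: every Galois `Y ∈ B^temp(Γ)⁰` is dominated by a Galois `Y′ → Y` whose field of constants
`K_{U′}` contains a primitive `N`-th root of unity (`ℚ̄_p` has one: characteristic `0`, algebraically closed; a `G_{ℚ_p}`-translate of a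
primitive root is primitive).  [cite: MochizukiEtTh2009, Prop 4.2 (iii) p.315 (PDF p.89)] -/
theorem exists_galoisCover_isPrimitiveRoot (hcont : Continuous a) (N : ℕ+) (Y : ConnectedPart (BTemp Γ)) (hY : IsGaloisObj Y.obj) :
    ∃ (Y' : ConnectedPart (BTemp Γ)) (_ : IsGaloisObj Y'.obj) (_ : Y' ⟶ Y) (ζ : (PadicAlgCl p)ˣ),
      IsPrimitiveRoot ζ (N : ℕ) ∧ (ζ : PadicAlgCl p) ∈ fixFld p a ((CosetCat.equivConnectedPart hΓ).inverse.obj Y').sg := by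
  haveI : NeZero ((N : ℕ) : PadicAlgCl p) := ⟨by exact_mod_cast N.ne_zero⟩
  obtain ⟨ζ₀, hζ₀⟩ : ∃ ζ₀ : PadicAlgCl p, IsPrimitiveRoot ζ₀ (N : ℕ) := HasEnoughRootsOfUnity.prim
  haveI : FiniteDimensional ℚ_[p] (IntermediateField.adjoin ℚ_[p] ({ζ₀} : Set (PadicAlgCl p))) :=
    IntermediateField.adjoin.finiteDimensional (Algebra.IsAlgebraic.isAlgebraic ζ₀).isIntegral
  obtain ⟨Y', hY', c, γ, hγ⟩ :=
    exists_galoisCover_apply_mem_fixFld p a hΓ hcont (IntermediateField.adjoin ℚ_[p] ({ζ₀} : Set (PadicAlgCl p))) Y hY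
  have hζ : IsPrimitiveRoot (a γ ζ₀) (N : ℕ) := hζ₀.map_of_injective (a γ).injective
  refine ⟨Y', hY', c, (hζ.isUnit N.ne_zero).unit, hζ.isUnit_unit N.ne_zero, ?_⟩
  rw [IsUnit.unit_spec]
  exact hγ ζ₀ (IntermediateField.subset_adjoin ℚ_[p] _ (Set.mem_singleton ζ₀))

/-! ## §3 The cyclotomic covering law `hμ₀` at the hull -/

variable (R S : ((ConnectedPart (BTemp Γ))ᵒᵖ ⥤ CommMonCat.{0}) → Prop)

/-- **The cyclotomic covering law `hμ₀` HOLDS at the base-field-theoretic hull** (abc-iut-w6-d037's binder of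
`Prop42Sub.prop42_iii_mkOfModelCanonical_trivNH_of_cyclotomicLaw`, print's «`K_N ∋ ζ_N`»): every Galois `Y` is dominated by a Galois
`Y′ → Y` over which the `N`-torsion of `Ker Div_B(Y′)` is cyclic of order `N` — generated by the constant function `ζ_N ∈ K_{U′}` read in
`B(Y′) ≅ B₀(Γ/U′)`; EVERY `N`-torsion rational function is a power of it (and has trivial divisor).  [cite: MochizukiEtTh2009, Prop 4.2 (iii) p.315 (PDF p.89)] -/
theorem cyclotomicLaw (hcont : Continuous a) (N : ℕ+) (Y : ConnectedPart (BTemp Γ)) (hY : IsGaloisObj Y.obj) :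
    ∃ (Y' : ConnectedPart (BTemp Γ)) (_ : IsGaloisObj Y'.obj) (_ : Y' ⟶ Y),
      ∃ ζ : ((temperedFrobenioid p a ha hΓ R S).ratFnFunctor.obj (op Y'))ˣ,
        divB (temperedFrobenioid p a ha hΓ R S).divisorMonoid (temperedFrobenioid p a ha hΓ R S).ratFnFunctor
            (temperedFrobenioid p a ha hΓ R S).divBNatTrans (op Y')
            (ζ : (temperedFrobenioid p a ha hΓ R S).ratFnFunctor.obj (op Y')) = 1 ∧
          orderOf ζ = (N : ℕ) ∧
          ∀ u : ((temperedFrobenioid p a ha hΓ R S).ratFnFunctor.obj (op Y'))ˣ,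
            divB (temperedFrobenioid p a ha hΓ R S).divisorMonoid (temperedFrobenioid p a ha hΓ R S).ratFnFunctor
                (temperedFrobenioid p a ha hΓ R S).divBNatTrans (op Y')
                (u : (temperedFrobenioid p a ha hΓ R S).ratFnFunctor.obj (op Y')) = 1 →
              u ^ (N : ℕ) = 1 → u ∈ Subgroup.zpowers ζ := by
  obtain ⟨Y', hY', c, ζ, hζ, hζU⟩ := exists_galoisCover_isPrimitiveRoot p a hΓ hcont N Y hY
  refine ⟨Y', hY', c, ?_⟩
  -- the dictionary `B₀(Γ/U′) ≅ B(Y′)` of the engine, on units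
  let e : eqvFun p a ((equiv hΓ).inverse.obj Y') ≃* (temperedFrobenioid p a ha hΓ R S).ratFnFunctor.obj (op Y') :=
    TemperedFrobenioid.RankOneBase.ratFnEquiv (hpf p a ha) (rankOneBase p a ha hΓ)
      QuasiTemperoid.BTempConnected.connectedPart_isConnected QuasiTemperoid.BTempConnected.connectedPart_isTotallyEpimorphic
      QuasiTemperoid.BTempConnected.connectedPart_isOfFSMType R S (op Y')
  let eU : eqvFun p a ((equiv hΓ).inverse.obj Y') ≃* ((temperedFrobenioid p a ha hΓ R S).ratFnFunctor.obj (op Y'))ˣ :=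
    toUnits.trans (Units.mapEquiv e)
  -- the generator: the constant function `ζ`
  have hordb : orderOf (ofFixed p a ((equiv hΓ).inverse.obj Y') ζ hζU) = (N : ℕ) := by
    rw [orderOf_ofFixed]; exact hζ.eq_orderOf.symm
  have hbN : ofFixed p a ((equiv hΓ).inverse.obj Y') ζ hζU ^ (N : ℕ) = 1 := by
    rw [← hordb]; exact pow_orderOf_eq_one _
  refine ⟨eU (ofFixed p a ((equiv hΓ).inverse.obj Y') ζ hζU), ?_, ?_, ?_⟩
  · -- trivial divisor: `Div_B (b, [div₀ b]) = [div₀ b]` and `div₀` of a torsion function is `1`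
    change gpMap (TemperedFrobenioid.RankOneBase.toPfImage (hpf p a ha) (rankOneBase p a ha hΓ) (op Y'))
        (divZero p a ha ((equiv hΓ).inverse.obj Y') (ofFixed p a ((equiv hΓ).inverse.obj Y') ζ hζU)) = 1
    rw [divZero_eq_one_of_pow_eq_one p a ha _ _ N.pos hbN]
    exact map_one _
  · rw [MulEquiv.orderOf_eq, hordb]
  · intro u _ hu
    obtain ⟨i, hi⟩ := exists_ofFixed_pow_eq_of_pow_eq_one p a ((equiv hΓ).inverse.obj Y') hζ hζU (eU.symm u)
      (by rw [← map_pow, hu, map_one])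
    have hu' : u = eU (ofFixed p a ((equiv hΓ).inverse.obj Y') ζ hζU) ^ i := by
      rw [← map_pow, hi, MulEquiv.apply_symm_apply]
    rw [hu']
    exact Subgroup.npow_mem_zpowers _ _

/-! ## §4 The root law `hR` for `B` and [EtTh] Prop. 4.2 (iii) AS TYPED at the hull over `B^temp(Π^tp_X)⁰` -/

/-- **The E2 root law `hR` for the rational functions `B = B₀ ×_{(Φ^{ℝ-log})^gp} Φ^gp` HOLDS at the hull** (Galois covers): A10
`baseRootLaw` (genuine Kummer coverings) + injectivity of `N`-th powers in `(Φ^{ℝ-log})^gp` (abc-iut-w6-d037's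
`pow_injective_ΦR_gp_treeVocabWeak`) through abc-iut-L2-t3's `rootLaw_of_baseRootLaw'`.  [cite: MochizukiEtTh2009, Prop 4.2 (iii) p.315 (PDF p.89)] -/
theorem rootLaw (hcont : Continuous a) (N : ℕ+) (A : ConnectedPart (BTemp Γ)) (hA : IsGaloisObj A.obj)
    (f : (temperedFrobenioid p a ha hΓ R S).ratFnFunctor.obj (op A)) :
    ∃ (A' : ConnectedPart (BTemp Γ)) (_ : IsGaloisObj A'.obj) (c : A' ⟶ A)
      (g : (temperedFrobenioid p a ha hΓ R S).ratFnFunctor.obj (op A')),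
      g ^ (N : ℕ) = pull (temperedFrobenioid p a ha hΓ R S).ratFnFunctor c f :=
  (temperedFrobenioid p a ha hΓ R S).rootLaw_of_baseRootLaw' (fun A : ConnectedPart (BTemp Γ) => IsGaloisObj A.obj) (hP p a ha hΓ R S)
    (fun A _ hM => RealifiedDivisorMonoids.pow_injective_ΦR_gp_treeVocabWeak _ (op ((temperedFrobenioid p a ha hΓ R S).base.obj A)) hM)
    (baseRootLaw p a ha hΓ R S hcont) N A hA f

end Hull

section Setting4

variable (p : ℕ) [Fact p.Prime] {K : Type} [Field K] (X : TemperedArithmeticGroup.{0} K) (a : X.Pi →* GQp p)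
  (ha : ∀ U : OpenSubgroup X.Pi, IsOpen ((U.toSubgroup.map a : Subgroup (GQp p)) : Set (GQp p)))
  (R S : ((ConnectedPart (BTemp X.Pi))ᵒᵖ ⥤ CommMonCat.{0}) → Prop)

/-- **[EtTh] Prop. 4.2 (iii) AS TYPED AT THE BASE-FIELD-THEORETIC HULL over the genuine base `B^temp(Π^tp_X)⁰` — N-th-root objects
EXIST**: for abc-iut-L2-t4's §4 setting `mkOfConnectedTemperoid X (BsFldHull.temperedFrobenioid …) …` (any pre-root-Frobenius-trivial
Galois-based `A_⊙`, trivial `(N,H)`-slot) the typed Prop. 4.2 (iii) (`BiKummerSetting.Prop42_iii`) holds, every binder of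
abc-iut-w6-d037's `Prop42Sub.prop42_iii_mkOfModelCanonical_trivNH_of_cyclotomicLaw` being a THEOREM here: `Φ` divisorial (Def. 3.6 (ii)),
`hDSpull` (rank one), `hR` (Kummer root law), `hμ₀` (`cyclotomicLaw`), `hS` (abc-iut-L2-t4's `mkOfConnectedTemperoid_galoisSurj_natural`).
[cite: MochizukiEtTh2009, Prop 4.2 (iii) p.314 (PDF p.88)] -/
theorem prop42_iii_mkOfConnectedTemperoid_trivNH (hcont : Continuous a)
    (A₀ : (temperedFrobenioid p a ha X.isTempered R S).category)
    (hA₀ : PreFrobenioid.IsFrobeniusTrivial (temperedFrobenioid p a ha X.isTempered R S).toElem A₀) (hA₀' : IsGaloisObj A₀.base.obj) :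
    (BiKummerSetting.mkOfConnectedTemperoid X (temperedFrobenioid p a ha X.isTempered R S) rfl (hP p a ha X.isTempered R S)
        (fun _ _ _ => True) A₀ hA₀ hA₀').Prop42_iii
      (fun {_ _} φ x => (temperedFrobenioid p a ha X.isTempered R S).pullFracModel φ x) :=
  BiKummerSetting.Prop42Sub.prop42_iii_mkOfModelCanonical_trivNH_of_cyclotomicLaw X (temperedFrobenioid p a ha X.isTempered R S) rfl
    (hP p a ha X.isTempered R S) _ _ _ A₀ hA₀ hA₀' (temperedFrobenioid p a ha X.isTempered R S).isDivisorial_divisorMonoid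
    (hDSpull p a ha X.isTempered R S) (rootLaw p a ha X.isTempered R S hcont) (cyclotomicLaw p a ha X.isTempered R S hcont)
    (BiKummerSetting.mkOfConnectedTemperoid_galoisSurj_natural X (temperedFrobenioid p a ha X.isTempered R S) rfl
      (hP p a ha X.isTempered R S) (fun _ _ _ => True) A₀ hA₀ hA₀')

end Setting4

end BsFldHull

end Literature.AnabelianGeometry.EtaleTheta

end
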